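import Summits.CriticalPhenomena.PercolationContinuityZ3.Theorems.Transplant.SkelFrmFrom1HoldsAll
import Summits.CriticalPhenomena.PercolationContinuityZ3.Theorems.Transplant.CayleyNilpotentFrom
import HarnessLib

/-!
# The node variant D″(κ′) `SamePDropOfSkeletonNegFrom₁` — a COROLLARY of the universal one-type node U in the tree, and its customers UNCONDITIONAL:
# `θ(p_c) = 0` on every `Cay(Γ; S)` with a `CayleyNeg₃` (additive unit-range chart, ONE reversing automorphism, finitely generated kernel) and on the
# letters-only Cayley graph of every nilpotent group with an inversion-symmetric rank-2 letter quotient (`NilNeg.NegData`, any class)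

builds on p205010 (kernel theorem, internal audit signed; external expert review pending).
Lane `prim-bschramm`, hp-8 lineage (g55); helper file (`--supports stmt-CriticalPhenomena-4575 --as helper`); PROOFS ONLY (one-liners over landed theorems).
No mathematics lives here: the implication U ⟹ D″(κ′) is `samePDropOfSkeletonNegFrom₁_of_frmFrom₁` («PlanarSkeletonFrmFromDefs», forget the inversion), and U
is IN THE TREE (`Transplant.samePDropOfSkeletonFrmFrom₁_holds`, «SkelFrmFrom1HoldsAll» p464817; AUDIT-U signed 2026-08-26).  The customers of D″(κ′) typed by
the p4 lineage (gen 12, «CayleySkeletonFrom» / «CayleyNilpotentFrom», hypothesis `hN : SamePDropOfSkeletonNegFrom₁`) are discharged here BY NAME; every one of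
them is also a special case of a U-customer already unconditional in «SkeletonFrmFrom1CustomersHolds» (`CayleyNeg₃ ⟶ CayleyFrm₃.ofNeg₃`,
`NilNeg.NegData ⟶ NilFrm.ofNegData`), so nothing new is claimed about any graph — the file only closes the tree's `…_of_negFromNode₁` rows.
(The `FreeNilClass.letters_…_of_negFromNode₁` rows have conclusions literally equal to the landed `FreeNilClass.letters_theta_eq_zero_of_le_holds` /
`letters_criticalContinuity_holds` and are therefore not restated.)
* §1 the node variant: `samePDropOfSkeletonNegFrom₁_holds`; its normal form at criticality; the customers' one-liner `continuity_of_negFromNode₁` DISCHARGED.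
* §2 `CayleyNeg₃.theta_eq_zero_of_le_holds` / `criticalContinuity_holds`; `NilNeg.NegData.theta_eq_zero_of_le_holds` / `criticalContinuity_holds`.
[cite: BenjaminiSchramm1996, Conj. 4; §2 (Cayley graphs)] [cite: KozmaNitzan2024, §1 p. 2 (approach 1); §4 pp. 15–31]
-/

noncomputable section

namespace Summit.CriticalPhenomena.PercolationContinuityZ3.Theorems.Transplant

open MeasureTheory SimpleGraph Literature.Probability.LatticeModels Literature.Probability.Percolation
open scoped Classical

/-! ## §1 The node variant D″(κ′) holds -/

/-- **THE NODE VARIANT D″(κ′) HOLDS**: `SamePDropOfSkeletonNegFrom₁` — for every connected, locally finite, countable graph carrying a `PlanarSkeletonNegFrom`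
(translating frames, the central inversion, unit steps, cylinders connected from some width `ℓ₀` on) with one base vertex type `t`, every `p < 1` with a.s.
uniqueness, subcritical cylinders and `θ_t(p) > 0` admits `q < p` with `θ_t(q) > 0`.  Corollary of the universal node U (`samePDropOfSkeletonFrmFrom₁_holds`,
p464817) through `samePDropOfSkeletonNegFrom₁_of_frmFrom₁` (forget the inversion).
builds on p205010 (kernel theorem, internal audit signed; external expert review pending). [cite: BenjaminiSchramm1996, Conj. 4] [cite: KozmaNitzan2024, §4] -/
theorem samePDropOfSkeletonNegFrom₁_holds : SamePDropOfSkeletonNegFrom₁ :=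
  samePDropOfSkeletonNegFrom₁_of_frmFrom₁ samePDropOfSkeletonFrmFrom₁_holds

/-- **The node variant AT CRITICALITY** (normal form `samePDropOfSkeletonNegFrom₁_iff_critical`): on every connected, locally finite, countable graph with a
one-type `PlanarSkeletonNegFrom`, `p_c(G,t) < 1`, a.s. uniqueness at `p_c` and subcritical cylinders at `p_c` give `θ_t(p_c) = 0`.
builds on p205010 (kernel theorem, internal audit signed; external expert review pending). [cite: BenjaminiSchramm1996, Conj. 4] -/
theorem negFrom₁CriticalContinuity_critical_holds :
    ∀ {V : Type} [DecidableEq V] [Countable V] (G : SimpleGraph V) [G.LocallyFinite] (Φ : PlanarSkeletonNegFrom G),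
      G.Connected → ∀ t ∈ Φ.types, Φ.types = {t} → criticalProb G t < 1 →
        (∀ᵐ ω ∂bondPercolation G (criticalProbIOf G t), numInfiniteClusters ω ≤ 1) →
          Φ.CylSubcritical (criticalProbIOf G t) → theta G t (criticalProbIOf G t) = 0 :=
  samePDropOfSkeletonNegFrom₁_iff_critical.1 samePDropOfSkeletonNegFrom₁_holds

/-- **THE CUSTOMERS' ONE-LINER OF D″(κ′), DISCHARGED** (`continuity_of_negFromNode₁` with its hypothesis `hD` supplied by §1): on a connected locally finite
graph with a one-type `PlanarSkeletonNegFrom` and subcritical cylinders at `p_c`, `θ_t(p_c) = 0`.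
builds on p205010 (kernel theorem, internal audit signed; external expert review pending). [cite: BenjaminiSchramm1996, Conj. 4] -/
theorem negFrom₁CriticalContinuity_holds {V : Type} (G : SimpleGraph V) [G.LocallyFinite] (Φ : PlanarSkeletonNegFrom G) (hc : G.Connected) (t : V)
    (ht : t ∈ Φ.types) (h1 : Φ.types = {t}) (hC : Φ.CylSubcritical (criticalProbIOf G t)) : theta G t (criticalProbIOf G t) = 0 :=
  continuity_of_negFromNode₁ samePDropOfSkeletonNegFrom₁_holds G Φ hc t ht h1 hC

/-! ## §2 The customers of D″(κ′), unconditional -/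

namespace CayleyNeg₃

variable {Γ : Type} [Group Γ] {S : Finset Γ}

/-- **THEOREM (UNCONDITIONAL in the tree): for every `CayleyNeg₃ Γ S` — additive unit-range skeleton, ONE reversing automorphism, finitely generated kernel —
`θ_g(p) = 0` on `Cay(Γ; S)` for every `p ≤ p_c` at every vertex.** (`theta_eq_zero_of_le_of_negFromNode₁` + `samePDropOfSkeletonNegFrom₁_holds`; also a special
case of `CayleyFrm₃.theta_eq_zero_of_le_holds` via `CayleyFrm₃.ofNeg₃`.) [cite: BenjaminiSchramm1996, Conj. 4; §2] [cite: KozmaNitzan2024, §1 p. 2 (approach 1)] -/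
theorem theta_eq_zero_of_le_holds (C : CayleyNeg₃ Γ S) (g : Γ) {p : unitInterval} (hp : (p : ℝ) ≤ criticalProb (mulCayley (↑S : Set Γ)) g) :
    theta (mulCayley (↑S : Set Γ)) g p = 0 :=
  C.theta_eq_zero_of_le_of_negFromNode₁ samePDropOfSkeletonNegFrom₁_holds g hp

/-- **`θ_g(p_c) = 0` on `Cay(Γ; S)` for every `CayleyNeg₃`, unconditionally.** [cite: BenjaminiSchramm1996, Conj. 4; §2] -/
theorem criticalContinuity_holds (C : CayleyNeg₃ Γ S) (g : Γ) : theta (mulCayley (↑S : Set Γ)) g (criticalProbIOf (mulCayley (↑S : Set Γ)) g) = 0 :=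
  C.criticalContinuity_of_negFromNode₁ samePDropOfSkeletonNegFrom₁_holds g

end CayleyNeg₃

namespace NilNeg

namespace NegData

variable {Γ : Type} [Group Γ]

/-- **THEOREM (UNCONDITIONAL in the tree): `θ_g(p) = 0` for every `p ≤ p_c` at every vertex of the LETTERS-ONLY Cayley graph `Cay(Γ; A)` of a nilpotent group of
ANY class with an inversion-symmetric rank-2 letter quotient (`NilNeg.NegData`).** (`theta_eq_zero_of_le_of_negFromNode₁` + `samePDropOfSkeletonNegFrom₁_holds`;
also a special case of `NilFrm.Data.theta_eq_zero_of_le_holds` via `NilFrm.ofNegData`.) [cite: BenjaminiSchramm1996, Conj. 4; §2] -/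
theorem theta_eq_zero_of_le_holds (D : NilNeg.NegData Γ) (g : Γ) {p : unitInterval} (hp : (p : ℝ) ≤ criticalProb (mulCayley (↑D.A : Set Γ)) g) :
    theta (mulCayley (↑D.A : Set Γ)) g p = 0 :=
  D.theta_eq_zero_of_le_of_negFromNode₁ samePDropOfSkeletonNegFrom₁_holds g hp

/-- **`θ_g(p_c) = 0` on the letters-only `Cay(Γ; A)` for every `NilNeg.NegData`, unconditionally.** [cite: BenjaminiSchramm1996, Conj. 4; §2] -/
theorem criticalContinuity_holds (D : NilNeg.NegData Γ) (g : Γ) :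
    theta (mulCayley (↑D.A : Set Γ)) g (criticalProbIOf (mulCayley (↑D.A : Set Γ)) g) = 0 :=
  D.criticalContinuity_of_negFromNode₁ samePDropOfSkeletonNegFrom₁_holds g

end NegData

end NilNeg

end Summit.CriticalPhenomena.PercolationContinuityZ3.Theorems.Transplant

end
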